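import Literature.Probability.Percolation.ArmSeparationOutSlotsFour
import Literature.Probability.Percolation.ArmSeparationSlotSep
import Literature.Probability.Percolation.ArmSeparationInMoveFour
import HarnessLib

/-!
# Slots of the four-arm inner landing step: ring roads, routing data and the events of a slot

Topic `Literature/Probability/Percolation`; family `crit-perc` / near-critical percolation on `𝕋`.
A brick of the near-critical arm-separation theorem for four arms of alternating colours
(P. Nolin, *Near-critical percolation in two dimensions*, EJP 13 (2008), Thm. 11 for `j = 4`,
`σ = BWBW` [arXiv 0711.4948: Thm. 10], landing step of the INTERNAL extremities, §4.4 p. 13 with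
Prop. 12 (i) and Lemma 13 [arXiv Prop. 11, Lemma 12]; H. Kesten, CMP 109 (1987), Lemma 2, §2).
The inner twin of `ArmSeparationOutSlotsFour.lean`: the four fenced inner tips of
`IntTinyExt4 m N k₀ K R₀` (`ArmSeparationIntSurgeryFour.lean`), in the cyclic order of their outer
landing sides, are landed on the sides `0, 2, 3, 5` of `∂Λ_n` (`m = 2n + 1`) along ring roads INSIDE
`Λ_m` (radii `irL ℓ ≈ m - (2ℓ+1) μ`, eight levels), reached by spokes from the tips and left by
approach tubes into the inner free spaces; arm `e` (landing inner side `ts e`) is the arm whose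
outer end is landed on the side `os e` (`= ts e`, or `ts e + 3` for a twisted slot). This file fixes
the parameters, the routing data (`InSlot4`, `RouteOK`) and the events of a slot (`armE`, `corrE`,
read through `Slot4.psiCfg`), their monotonicity, supports and locality. Everything here is proved;
no named facts are introduced.

## References

* P. Nolin, Near-critical percolation in two dimensions, *Electron. J. Probab.* 13 (2008), §4.2
  Def. 6–8, §4.3 Prop. 12, Lemma 13, §4.4 (arXiv 0711.4948: Def. 6–8, Prop. 11, Lemma 12, proof of
  Thm. 10, p. 13) [Nolin2008].
* H. Kesten, Scaling relations for 2D-percolation, *Comm. Math. Phys.* 109 (1987), Lemma 2, §2 [Kesten1987].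
-/

noncomputable section

open Set MeasureTheory

namespace Literature.Probability.Percolation

open LatticeModels HalfAnnulus Tube

/-! ### Ring roads, spokes, approach tubes and target rows -/

namespace LParams

variable (P : LParams)

/-- radius of the inner ring road of level `ℓ`: the multiple of `s` in `(m - (2ℓ+1)μ - s, m - (2ℓ+1)μ]` [folklore] -/
def irL (ℓ : ℕ) : ℕ := P.s * ((P.m - (2 * ℓ + 1) * P.μ) / P.s)
/-- chunks per side of the ring of level `ℓ` [folklore] -/
def inL (ℓ : ℕ) : ℕ := P.irL ℓ / P.s
/-- number of tubes of the ring of level `ℓ` [folklore] -/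
def iGr (ℓ : ℕ) : ℕ := 12 * P.inL ℓ - 4
/-- length of a spoke reaching down to the ring of level `ℓ` [folklore] -/
def iLL (ℓ : ℕ) : ℕ := (2 * ℓ + 1) * P.μ + 2 * P.s + 4 * P.e
/-- width of an approach tube leaving the ring of level `ℓ`: `n - n/8 + 1 + iWL ℓ = irL ℓ + 2e` [folklore] -/
def iWL (ℓ : ℕ) : ℕ := P.irL ℓ + 2 * P.e + P.n / 8 - 1 - P.n
/-- spacing of the candidate target rows (their danger zones are disjoint) [folklore] -/
def isp : ℕ := P.n / 64 + 2 * P.μ + 16 * P.s + 1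
/-- the `c`-th candidate target row, `c < 5`: `tgtRow n false + c sp` [folklore] -/
def itgtRow4 (c : ℕ) : ℤ := tgtRow P.n false + c * P.isp

variable {P}

/-- **The inner ring of level `ℓ < 8` of a valid rung**: radius in `(m - (2ℓ+1)μ - s, m - (2ℓ+1)μ]`, a
multiple of `s = k₀`, at least one chunk, above `∂Λ_n` with room for the approach tube. [folklore] -/
theorem Valid.iring_facts (hV : P.Valid) {ℓ : ℕ} (hℓ : ℓ < 8) :
    P.irL ℓ ≤ P.m - (2 * ℓ + 1) * P.μ ∧ P.m - (2 * ℓ + 1) * P.μ < P.irL ℓ + P.s ∧ P.inL ℓ * P.s = P.irL ℓ ∧ 1 ≤ P.inL ℓ ∧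
      P.n - P.n / 8 + 1 + P.iWL ℓ = P.irL ℓ + 2 * P.e ∧ P.n + P.s + 2 * P.e ≤ P.irL ℓ ∧ P.irL ℓ + 2 * P.e ≤ P.m ∧
      P.iGr ℓ = 12 * P.inL ℓ - 4 ∧ P.iLL ℓ = (2 * ℓ + 1) * P.μ + 2 * P.s + 4 * P.e := by
  obtain ⟨hs, -, he, -, hk₀, hkμ, -, -, -, -, -, -, hm, -, hn, hμn, -, -⟩ := hV.facts
  have hk : 1 ≤ P.k₀ := le_trans (by norm_num) hk₀
  have hμ15 : (2 * ℓ + 1) * P.μ ≤ 15 * P.μ := Nat.mul_le_mul_right _ (by omega)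
  have h1 : P.irL ℓ ≤ P.m - (2 * ℓ + 1) * P.μ := by unfold LParams.irL; rw [hs]; exact Nat.mul_div_le _ _
  have h2 : P.m - (2 * ℓ + 1) * P.μ < P.irL ℓ + P.s := by
    unfold LParams.irL; rw [hs]; conv_rhs => rw [Nat.mul_comm]
    exact Nat.lt_div_mul_add hk
  have h3 : P.inL ℓ * P.s = P.irL ℓ := by
    unfold LParams.inL LParams.irL; rw [hs, Nat.mul_div_cancel_left _ hk, mul_comm]
  have he' : P.e ≤ P.k₀ := by rw [he]; exact Nat.div_le_self _ _
  have he2 : 2 * P.e ≤ P.k₀ := by rw [he]; omega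
  have hle : (2 * ℓ + 1) * P.μ ≤ P.m := by omega
  have h6 : P.n + P.s + 2 * P.e ≤ P.irL ℓ := by rw [hs]; omega
  have h4 : 1 ≤ P.inL ℓ := by
    refine Nat.pos_of_ne_zero fun h0 => ?_
    rw [h0, zero_mul] at h3; omega
  have h7 : P.irL ℓ + 2 * P.e ≤ P.m := by
    have : P.μ ≤ (2 * ℓ + 1) * P.μ := Nat.le_mul_of_pos_left _ (by omega)
    omega
  have h5 : P.n - P.n / 8 + 1 + P.iWL ℓ = P.irL ℓ + 2 * P.e := by
    unfold LParams.iWL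
    have h8 : P.n / 8 ≤ P.n := Nat.div_le_self _ _
    omega
  exact ⟨h1, h2, h3, h4, h5, h6, h7, rfl, rfl⟩

/-- **The integer ring facts**, cast to `ℤ`. [folklore] -/
theorem Valid.iring_ifacts (hV : P.Valid) {ℓ : ℕ} (hℓ : ℓ < 8) :
    (P.irL ℓ : ℤ) ≤ P.m - (2 * ℓ + 1) * P.μ ∧ (P.m : ℤ) - (2 * ℓ + 1) * P.μ < P.irL ℓ + P.s ∧
      ((P.inL ℓ : ℕ) : ℤ) * P.s = P.irL ℓ ∧ (P.n : ℤ) - (P.n / 8 : ℕ) + 1 + P.iWL ℓ = P.irL ℓ + 2 * P.e ∧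
      (P.n : ℤ) + P.s + 2 * P.e ≤ P.irL ℓ ∧ (P.irL ℓ : ℤ) + 2 * P.e ≤ P.m ∧ (P.iLL ℓ : ℤ) = (2 * ℓ + 1) * P.μ + 2 * P.s + 4 * P.e := by
  obtain ⟨h1, h2, h3, -, h5, h6, h7, -, h9⟩ := hV.iring_facts hℓ
  obtain ⟨-, -, -, -, -, -, -, -, -, -, -, -, hm, -, hn, hμn, -, -⟩ := hV.facts
  have hμ15 : (2 * ℓ + 1) * P.μ ≤ 15 * P.μ := Nat.mul_le_mul_right _ (by omega)
  have hle : (2 * ℓ + 1) * P.μ ≤ P.m := by omega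
  refine ⟨?_, ?_, by exact_mod_cast h3, ?_, by exact_mod_cast h6, by exact_mod_cast h7, by rw [h9]; push_cast; ring⟩
  · have : ((P.m - (2 * ℓ + 1) * P.μ : ℕ) : ℤ) = P.m - (2 * ℓ + 1) * P.μ := by push_cast [hle]; ring
    have h1' : (P.irL ℓ : ℤ) ≤ ((P.m - (2 * ℓ + 1) * P.μ : ℕ) : ℤ) := by exact_mod_cast h1
    rw [this] at h1'; exact h1'
  · have : ((P.m - (2 * ℓ + 1) * P.μ : ℕ) : ℤ) = P.m - (2 * ℓ + 1) * P.μ := by push_cast [hle]; ring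
    have h2' : ((P.m - (2 * ℓ + 1) * P.μ : ℕ) : ℤ) < P.irL ℓ + P.s := by exact_mod_cast h2
    rw [this] at h2'; exact h2'
  · have h8 : P.n / 8 ≤ P.n := Nat.div_le_self _ _
    omega

/-- The rings have at most as many chunks as the outermost one (`ℓ < 8`). [folklore] -/
theorem Valid.inL_le_inL_zero (hV : P.Valid) {ℓ : ℕ} (hℓ : ℓ < 8) :
    P.inL ℓ ≤ P.inL 0 := by
  obtain ⟨h1, -, h3, -⟩ := hV.iring_facts hℓ
  obtain ⟨-, g2, g3, -⟩ := hV.iring_facts (show 0 < 8 by norm_num)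
  have hs : 0 < P.s := by have := hV.facts.1; have := hV.facts.2.2.2.2.1; omega
  have hμ : (2 * 0 + 1) * P.μ ≤ (2 * ℓ + 1) * P.μ := Nat.mul_le_mul_right _ (by omega)
  have hlt : P.inL ℓ * P.s < (P.inL 0 + 1) * P.s := by rw [add_mul, one_mul, h3, g3]; omega
  have := Nat.lt_of_mul_lt_mul_right hlt
  omega

/-- **The candidate target rows of a valid rung** lie in the middle landing band:
`-n + n/4 + n/16 ≤ itgtRow4 c ≤ -n/4 - n/16` for `c < 5`. [folklore] -/
theorem Valid.itgtRow4_mem (hV : P.Valid) (hK : 1 ≤ P.K) {c : ℕ} (hc : c < 5) :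
    -(P.n : ℤ) + (P.n / 4 : ℕ) + (P.n / 16 : ℕ) ≤ P.itgtRow4 c ∧ P.itgtRow4 c ≤ -((P.n / 4 : ℕ) : ℤ) - (P.n / 16 : ℕ) := by
  obtain ⟨hs, -, -, -, hk₀, hkμ, -, -, -, -, -, -, hm, -, hn, hμn, -, -⟩ := hV.facts
  have h32 : 32 * P.k₀ ≤ P.μ := by have := P.scale_le hK; unfold trapScale at this; simpa using this
  have hsp : (P.isp : ℤ) = (P.n / 64 : ℕ) + 2 * P.μ + 16 * P.s + 1 := by unfold LParams.isp; push_cast; ring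
  have hc' : (c : ℤ) ≤ 4 := by exact_mod_cast Nat.le_of_lt_succ hc
  have hc0 : (0 : ℤ) ≤ (c : ℤ) * P.isp := by positivity
  have hc4 : (c : ℤ) * P.isp ≤ 4 * P.isp := by nlinarith [(show (0 : ℤ) ≤ P.isp from by positivity)]
  unfold itgtRow4
  simp only [tgtRow, cond_false]
  constructor
  · linarith
  · rw [hs] at hsp
    have h32' : 32 * (P.k₀ : ℤ) ≤ P.μ := by exact_mod_cast h32
    omega

end LParams

/-! ### Slots -/

/-- **A slot of the four-arm inner landing step**: seven rows of data, one entry per arm `e`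
(arms indexed by inner landing side: `e = 0, 1, 2, 3` land on the sides `0, 2, 3, 5`, colours
open/closed/open/closed): `0` frame of the tip, `1` scale index, `2` tip-row window, `3` target-row
choice, `4` level of the ring, `5` start and `6` length of the arc; and the twist bit: the arm
landing at the inner side `ts e` has its outer end landed on the side `ts e` (`tw = false`) or
`ts e + 3` (`tw = true`). [cite: Nolin2008, §4.4 (arXiv 0711.4948: Thm. 10, internal extremities)] -/
structure InSlot4 where
  /-- the seven rows of data -/
  f : Fin 7 → Fin 4 → ℕ
  /-- the twist -/
  tw : Bool

namespace InSlot4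

variable (P : LParams) (σ : InSlot4)

/-- frame of the tip of the arm `e` [folklore] -/
def fr (e : Fin 4) : ℕ := σ.f 0 e
/-- scale index of the tip of the arm `e` [folklore] -/
def sc (e : Fin 4) : ℕ := σ.f 1 e
/-- window index of the tip row of the arm `e` [folklore] -/
def wi (e : Fin 4) : ℕ := σ.f 2 e
/-- target-row choice of the arm `e` [folklore] -/
def tc (e : Fin 4) : ℕ := σ.f 3 e
/-- level of the ring of the arm `e` [folklore] -/
def lv (e : Fin 4) : ℕ := σ.f 4 e
/-- start of the arc of the arm `e` [folklore] -/
def ast (e : Fin 4) : ℕ := σ.f 5 e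
/-- length of the arc of the arm `e` [folklore] -/
def aln (e : Fin 4) : ℕ := σ.f 6 e
/-- outer landing side of the arm `e` [folklore] -/
def os (e : Fin 4) : ℕ := if σ.tw then (Slot4.ts e + 3) % 6 else Slot4.ts e
/-- outer landing side of the arm `e`, relative to the reading configuration [folklore] -/
def os' (e : Fin 4) : ℕ := if 2 ≤ (e : ℕ) then (σ.os e + 3) % 6 else σ.os e
/-- frame of the tip in the reading configuration (shifted by three for the reflected arms `e = 2, 3`) [folklore] -/
def fr' (e : Fin 4) : ℕ := if 2 ≤ (e : ℕ) then (σ.fr e + 3) % 6 else σ.fr e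

/-- scale of the tip of the arm `e` [folklore] -/
def k (e : Fin 4) : ℕ := trapScale P.k₀ (σ.sc e)
/-- window start of the tip row of the arm `e` [folklore] -/
def T (e : Fin 4) : ℤ := P.T₀ (σ.wi e)
/-- lateral position of beacon and spoke of the arm `e` (in its frame) [folklore] -/
def ξ (e : Fin 4) : ℤ := σ.T P e + 2 * σ.k P e + P.w
/-- ring radius of the arm `e` [folklore] -/
def r (e : Fin 4) : ℕ := P.irL (σ.lv e)
/-- chunks per side of the ring of the arm `e` [folklore] -/
def nr (e : Fin 4) : ℕ := P.inL (σ.lv e)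
/-- number of tubes of the ring of the arm `e` [folklore] -/
def G (e : Fin 4) : ℕ := P.iGr (σ.lv e)
/-- spoke length of the arm `e` [folklore] -/
def L (e : Fin 4) : ℕ := P.iLL (σ.lv e)
/-- approach width of the arm `e` [folklore] -/
def W (e : Fin 4) : ℕ := P.iWL (σ.lv e)
/-- target row of the arm `e` (lateral coordinate in the frame of its landing side) [folklore] -/
def t (e : Fin 4) : ℤ := P.itgtRow4 (σ.tc e)
/-- first lateral index of the exit run of the arm `e` [folklore] -/
def x (e : Fin 4) : ℕ := latIdx P.s (σ.r P e) (σ.t P e)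
/-- shift between absolute ring positions and positions in the reading configuration (half a ring
for the reflected arms) [folklore] -/
def shift (e : Fin 4) : ℕ := if 2 ≤ (e : ℕ) then 6 * σ.nr P e - 2 else 0
/-- absolute position ↦ position in the reading configuration of the arm `e` [folklore] -/
def toView (e : Fin 4) (p : ℕ) : ℕ := (p + σ.G P e - σ.shift P e) % σ.G P e
/-- position (reading configuration) of the entry piece of the arm `e` on its ring [folklore] -/
def pE (e : Fin 4) : ℕ := piecePos (σ.nr P e) (σ.fr' e) (latIdx P.s (σ.r P e) (σ.ξ P e))

/-- first position of the spoke window of the arm `b` on the ring of the arm `e` (absolute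
positions: the pieces of lateral index `ι - 1, ι, ι + 1` of the side `fr b` and their connectors,
`ι` the lateral index of the spoke of `b` on that ring) [folklore] -/
def spokeWinLo (b e : Fin 4) : ℕ :=
  blockOff (σ.nr P e) (σ.fr b) +
    (if σ.fr b % 3 = 2 then 2 * (σ.nr P e - 2 - latIdx P.s (σ.r P e) (σ.ξ P b)) else 2 * (latIdx P.s (σ.r P e) (σ.ξ P b) - 1))
/-- the approach window of the arm `b` on the ring of the arm `e` (absolute positions of the pieces of
the side `ts b` whose lateral indices cover the rows of the approach tube of `b`, with one index of
margin): first position [folklore] -/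
def apprWinLo (b e : Fin 4) : ℕ :=
  min (piecePos (σ.nr P e) (Slot4.ts b) (latIdx P.s (σ.r P e) (σ.t P b) - 1))
    (piecePos (σ.nr P e) (Slot4.ts b) (latIdx P.s (σ.r P e) (σ.t P b + (P.n / 64 : ℕ)) + 1))
/-- the approach window: last position [folklore] -/
def apprWinHi (b e : Fin 4) : ℕ :=
  max (piecePos (σ.nr P e) (Slot4.ts b) (latIdx P.s (σ.r P e) (σ.t P b) - 1))
    (piecePos (σ.nr P e) (Slot4.ts b) (latIdx P.s (σ.r P e) (σ.t P b + (P.n / 64 : ℕ)) + 1)) + 1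
/-- the exit run of the arm `e` on its own ring (reading positions of the pieces `x e, …, x e + d` of
the side `bs e` and their connectors): first position [folklore] -/
def runLo (e : Fin 4) : ℕ :=
  min (piecePos (σ.nr P e) (Slot4.bs e) (σ.x P e)) (piecePos (σ.nr P e) (Slot4.bs e) (σ.x P e + P.d))
/-- the exit run: last position [folklore] -/
def runHi (e : Fin 4) : ℕ :=
  max (piecePos (σ.nr P e) (Slot4.bs e) (σ.x P e)) (piecePos (σ.nr P e) (Slot4.bs e) (σ.x P e + P.d))

/-- **The routing predicate of a slot** (as `Slot4.RouteOK`, with the inner geometry: arcs inside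
their rings; distinct levels; the entry piece and the exit run on the arc; the arc of `e` off the spoke
windows of the other-colour arms of LOWER level (whose spokes cross the ring of `e` on their way
down) and off the approach windows of the other-colour arms of HIGHER level (whose approach tubes
cross it); the target row of `e` off the danger zones of the other-colour tips sitting on its landing
side, and the converse; tips of different colours on a common frame in distant windows). [cite: Nolin2008, §4.3 Lemma 13 and §4.4 (arXiv 0711.4948: Lemma 12; proof of Thm. 10, p. 13)] -/
def RouteOK (P : LParams) (σ : InSlot4) : Prop :=
  (∀ e : Fin 4, σ.ast e < σ.G P e ∧ 1 ≤ σ.aln e ∧ σ.aln e ≤ σ.G P e) ∧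
  (∀ e b : Fin 4, e ≠ b → σ.lv e ≠ σ.lv b) ∧
  (∀ e : Fin 4, InArc (σ.G P e) (σ.ast e) (σ.aln e) (σ.pE P e)) ∧
  (∀ e : Fin 4, ∀ p : ℕ, p < σ.G P e → σ.runLo P e ≤ p → p ≤ σ.runHi P e → InArc (σ.G P e) (σ.ast e) (σ.aln e) p) ∧
  (∀ e b : Fin 4, Slot4.col e ≠ Slot4.col b → σ.lv e < σ.lv b →
    ∀ q : ℕ, q < 6 → ¬ InArc (σ.G P e) (σ.ast e) (σ.aln e) (σ.toView P e (σ.spokeWinLo P b e + q))) ∧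
  (∀ e b : Fin 4, Slot4.col e ≠ Slot4.col b → σ.lv b < σ.lv e →
    ∀ p : ℕ, p < 12 * σ.nr P e → σ.apprWinLo P b e ≤ p → p ≤ σ.apprWinHi P b e →
      ¬ InArc (σ.G P e) (σ.ast e) (σ.aln e) (σ.toView P e p)) ∧
  (∀ e b : Fin 4, Slot4.col e ≠ Slot4.col b → σ.fr e = Slot4.ts b →
    σ.ξ P e + P.μ + 8 * P.s < σ.t P b ∨ σ.t P b + (P.n / 64 : ℕ) + P.μ + 8 * P.s < σ.ξ P e) ∧
  (∀ e b : Fin 4, Slot4.col e ≠ Slot4.col b → σ.fr e = σ.fr b →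
    σ.T P e + 8 * σ.k P e < σ.T P b + P.w ∨ σ.T P b + 8 * σ.k P b < σ.T P e + P.w)

/-- The routing predicate is (classically) decidable. [folklore] -/
instance (P : LParams) (σ : InSlot4) : Decidable (RouteOK P σ) := Classical.dec _

end InSlot4

/-- **The finitely many slots**: frames `< 6`, scale indices `< K`, windows `< Nw`, target choices
`< 5`, levels `< 8`, arc starts `≤ iGr 0` and lengths `≤ iGr 0` (the outermost ring is the longest). [folklore] -/
def inSlot4Bound (P : LParams) (q : Fin 7) : ℕ := (![6, P.K, P.Nw, 5, 8, P.iGr 0 + 1, P.iGr 0 + 1] : Fin 7 → ℕ) q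

/-- The data rows as a finset of functions. [folklore] -/
def inSlot4DataFinset (P : LParams) : Finset (Fin 7 → Fin 4 → ℕ) :=
  Fintype.piFinset fun q : Fin 7 => Fintype.piFinset fun _ : Fin 4 => Finset.range (inSlot4Bound P q)

/-- The slot finset. [folklore] -/
def inSlot4Finset (P : LParams) : Finset InSlot4 :=
  (inSlot4DataFinset P ×ˢ (Finset.univ : Finset Bool)).map ⟨fun p => InSlot4.mk p.1 p.2, fun a b h => by
    obtain ⟨h1, h2⟩ := InSlot4.mk.inj h; exact Prod.ext h1 h2⟩

/-- Membership in the slot finset, unfolded. [folklore] -/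
theorem mem_inSlot4Finset {P : LParams} {σ : InSlot4} : σ ∈ inSlot4Finset P ↔ ∀ q e, σ.f q e < inSlot4Bound P q := by
  unfold inSlot4Finset inSlot4DataFinset
  simp only [Finset.mem_map, Function.Embedding.coeFn_mk, Finset.mem_product, Fintype.mem_piFinset, Finset.mem_range,
    Finset.mem_univ, and_true, Prod.exists]
  constructor
  · rintro ⟨g, b, hg, rfl⟩; exact hg
  · intro h; exact ⟨σ.f, σ.tw, h, rfl⟩

/-- **The number of slots** is `2 ∏_q (inSlot4Bound P q)^4`, a function of `K`, `Nw` and `iGr 0` only. [folklore] -/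
theorem card_inSlot4Finset (P : LParams) : (inSlot4Finset P).card = (∏ q : Fin 7, inSlot4Bound P q ^ 4) * 2 := by
  unfold inSlot4Finset
  rw [Finset.card_map, Finset.card_product]
  have hb : (Finset.univ : Finset Bool).card = 2 := rfl
  rw [hb]
  congr 1
  unfold inSlot4DataFinset
  rw [Fintype.card_piFinset]
  refine Finset.prod_congr rfl fun q _ => ?_
  rw [Fintype.card_piFinset, Finset.prod_const, Finset.card_range, Finset.card_univ, Fintype.card_fin]

/-! ### The events -/

/-- **The inner corridor to the base side `bs`** (reading configuration): beacon, spoke, the arc, and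
— read through the frame `bs` (`0`: identity; `2`: transposition) — the approach tube
`[n - n/8 + 1, r + 2e] × [t, t + n/64]` crossed horizontally and the thinned target free space at
the landing row `t` crossed vertically. [cite: Nolin2008, §4.3 Prop. 12 (proof) (arXiv 0711.4948: Prop. 11)] -/
def icorrEvent4 (i m n k : ℕ) (T₀ : ℤ) (w L ε r e s a len bs : ℕ) (t : ℤ) (W : ℕ) : Set (SiteConfig (Site 2)) :=
  bcnEvent i m k T₀ w ∩ spokeEvent i m k T₀ w L ε ∩ eventAll (arc (thinRing r e s) a len) ∩
    {χ | frameConfig bs χ ∈ tgtH n t W} ∩ {χ | frameConfig bs χ ∈ tgtV n t}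

namespace InSlot4

variable (P : LParams) (σ : InSlot4)

/-- **The tiny-fenced inner arm of the arm slot `e`**: the outer end landed on the side `os e`
(landing site `z`, attaching site `u`, read in `frameConfig (os e)` of the colour-read
configuration), and a fenced inner arm of colour `col e` in the frame `fr e` with a middle tip, at
the scale index `sc e`, tip row in the window `wi e`, far end the attaching site. [cite: Nolin2008, §4.4 (arXiv 0711.4948: Thm. 10, internal extremities)] -/
def armE (e : Fin 4) : Set (SiteConfig (Site 2)) :=
  {ω | ∃ z u : Site 2, z ∈ sepLanding P.N ∧
    OpenVCrossThrough (sepOuterFence P.N z) (z 1 - (P.N / 64 : ℕ)) (z 1 + (P.N / 64 : ℕ))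
      (frameConfig (σ.os e) (colCfg (Slot4.col e) ω)) u ∧
    ∃ F : IntFencedArm P.m ((frameIso (σ.fr e)).symm '' (frameIso (σ.os e) '' armRegion P.m P.N z)) P.k₀ P.K P.R₀
      (frameConfig (σ.fr e) (colCfg (Slot4.col e) ω)),
      F.j = σ.sc e ∧ σ.T P e ≤ F.z 1 ∧ F.z 1 < σ.T P e + P.w ∧ F.b = (frameIso (σ.fr e)).symm (frameIso (σ.os e) u)}

/-- **The corridor of the arm slot `e`**, read in its reading configuration. [cite: Nolin2008, §4.3 Prop. 12 (proof) (arXiv 0711.4948: Prop. 11)] -/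
def corrE (e : Fin 4) : Set (SiteConfig (Site 2)) :=
  {ω | Slot4.psiCfg e ω ∈ icorrEvent4 (σ.fr' e) P.m P.n (σ.k P e) (σ.T P e) P.w (σ.L P e) P.ε (σ.r P e) P.e P.s (σ.ast e) (σ.aln e)
    (Slot4.bs e) (σ.t P e) (σ.W P e)}

end InSlot4

/-! ### Monotonicity -/

/-- The four-arm inner corridor event is increasing. [folklore] -/
theorem isUpperSet_icorrEvent4 (i m n k : ℕ) (T₀ : ℤ) (w L ε r e s a len bs : ℕ) (t : ℤ) (W : ℕ) :
    IsUpperSet (icorrEvent4 i m n k T₀ w L ε r e s a len bs t W) :=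
  ((((isUpperSet_bcnEvent i m k T₀ w).inter (isUpperSet_spokeEvent i m k T₀ w L ε)).inter (isUpperSet_eventAll _)).inter
    (isUpperSet_preimage_frameConfig bs (isUpperSet_triHCross _ _ _ _))).inter
    (isUpperSet_preimage_frameConfig bs (isUpperSet_triVCross _ _ _ _))

namespace InSlot4

variable (P : LParams) (σ : InSlot4)

/-- **The corridor of an open arm is increasing.** [folklore] -/
theorem isUpperSet_corrE {e : Fin 4} (hc : Slot4.col e = true) : IsUpperSet (σ.corrE P e) :=
  fun _ _ hle hω => isUpperSet_icorrEvent4 _ _ _ _ _ _ _ _ _ _ _ _ _ _ _ _ ((Slot4.psiCfg_mono_or_anti e hle).1 hc) hω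

/-- **The corridor of a closed arm is decreasing.** [folklore] -/
theorem isLowerSet_corrE {e : Fin 4} (hc : Slot4.col e = false) : IsLowerSet (σ.corrE P e) :=
  fun _ _ hle hω => isUpperSet_icorrEvent4 _ _ _ _ _ _ _ _ _ _ _ _ _ _ _ _ ((Slot4.psiCfg_mono_or_anti e hle).2 hc) hω

/-- Colour reading composed with a frame is monotone for open arms and antitone for closed arms. [folklore] -/
theorem frameConfig_colCfg_mono_or_anti (i : ℕ) (e : Fin 4) {ω ω' : SiteConfig (Site 2)} (h : ω ≤ ω') :
    (Slot4.col e = true → frameConfig i (colCfg (Slot4.col e) ω) ≤ frameConfig i (colCfg (Slot4.col e) ω')) ∧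
      (Slot4.col e = false → frameConfig i (colCfg (Slot4.col e) ω') ≤ frameConfig i (colCfg (Slot4.col e) ω)) := by
  constructor <;> intro hc <;> rw [hc]
  · exact frameConfig_mono i (colCfg_true_mono h)
  · exact frameConfig_mono i (colCfg_false_anti h)

/-- **The arm event of an open arm is increasing.** [folklore] -/
theorem isUpperSet_armE {e : Fin 4} (hc : Slot4.col e = true) : IsUpperSet (σ.armE P e) := by
  intro ω ω' hle hω
  obtain ⟨z, u, hz, hOut, F, hj, h1, h2, hb⟩ := hω
  exact ⟨z, u, hz, openVCrossThrough_mono ((frameConfig_colCfg_mono_or_anti _ e hle).1 hc) hOut,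
    F.mapMono ((frameConfig_colCfg_mono_or_anti _ e hle).1 hc), hj, h1, h2, hb⟩

/-- **The arm event of a closed arm is decreasing.** [folklore] -/
theorem isLowerSet_armE {e : Fin 4} (hc : Slot4.col e = false) : IsLowerSet (σ.armE P e) := by
  intro ω ω' hle hω
  obtain ⟨z, u, hz, hOut, F, hj, h1, h2, hb⟩ := hω
  exact ⟨z, u, hz, openVCrossThrough_mono ((frameConfig_colCfg_mono_or_anti _ e hle).2 hc) hOut,
    F.mapMono ((frameConfig_colCfg_mono_or_anti _ e hle).2 hc), hj, h1, h2, hb⟩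

end InSlot4

/-! ### Supports -/

/-- **The support of a four-arm inner corridor**: `frameIso i` of the slot frame box and of the
spoke's box, the sites of the arc, and `frameIso bs` of the approach box and of the target box. [cite: Nolin2008, §4.3 Lemma 13 (arXiv 0711.4948: Lemma 12, the sets `𝒜^±`)] -/
def icorrFin4 (i m n k : ℕ) (T₀ : ℤ) (w L ε r e s a len bs : ℕ) (t : ℤ) (W : ℕ) : Finset (Site 2) :=
  (slotFrame m k T₀ w ∪ (spokeTube m k T₀ w L ε).sites).image (frameIso i) ∪ sitesAll (arc (thinRing r e s) a len) ∪
    (triStripFinset ((n : ℤ) - (n / 8 : ℕ) + 1) t W (n / 64) ∪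
      triStripFinset ((n : ℤ) - (n / 8 : ℕ) + 1) (t - (n / 64 : ℕ)) (n / 8 - 2) (2 * (n / 64))).image (frameIso bs)

/-- The support of a four-arm inner corridor, as a set. [folklore] -/
theorem coe_icorrFin4 (i m n k : ℕ) (T₀ : ℤ) (w L ε r e s a len bs : ℕ) (t : ℤ) (W : ℕ) :
    (↑(icorrFin4 i m n k T₀ w L ε r e s a len bs t W) : Set (Site 2)) =
      frameIso i '' ((↑(slotFrame m k T₀ w) : Set (Site 2)) ∪ (spokeTube m k T₀ w L ε).box) ∪ boxAll (arc (thinRing r e s) a len) ∪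
        frameIso bs '' (triStrip ((n : ℤ) - (n / 8 : ℕ) + 1) t W (n / 64) ∪
          triStrip ((n : ℤ) - (n / 8 : ℕ) + 1) (t - (n / 64 : ℕ)) (n / 8 - 2) (2 * (n / 64))) := by
  unfold icorrFin4
  rw [Finset.coe_union, Finset.coe_union, Finset.coe_image, Finset.coe_image, Finset.coe_union, Finset.coe_union, coe_sites,
    coe_sitesAll, coe_triStripFinset, coe_triStripFinset]

/-- **The four-arm inner corridor event is determined by its support** (`2 ≤ k`). [folklore] -/
theorem determinedBy_icorrEvent4 {i m n k : ℕ} (hk : 2 ≤ k) (T₀ : ℤ) (w L ε r e s a len bs : ℕ) (t : ℤ) (W : ℕ) :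
    DeterminedBy (icorrEvent4 i m n k T₀ w L ε r e s a len bs t W) ↑(icorrFin4 i m n k T₀ w L ε r e s a len bs t W) := by
  unfold icorrEvent4 tgtH tgtV
  rw [coe_icorrFin4]
  have d1 : DeterminedBy (bcnEvent i m k T₀ w) (frameIso i '' ↑(triSqAnnulusFinset (bcnCentre m k T₀ w) (k / 2) (2 * (k / 2)))) :=
    determinedBy_preimage_frameConfig i (determinedBy_triFrameAt _ _)
  have d2 := determinedBy_spokeEvent i m k T₀ w L ε
  have d3 := determinedBy_eventAll (arc (thinRing r e s) a len)
  have d4 := determinedBy_preimage_frameConfig bs (determinedBy_triHCross ((n : ℤ) - (n / 8 : ℕ) + 1) t W (n / 64))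
  have d5 := determinedBy_preimage_frameConfig bs
    (determinedBy_triVCross ((n : ℤ) - (n / 8 : ℕ) + 1) (t - (n / 64 : ℕ)) (n / 8 - 2) (2 * (n / 64)))
  rw [coe_triStripFinset] at d4 d5
  rw [coe_sitesAll] at d3
  refine ((((d1.mono ?_).inter (d2.mono ?_)).inter (d3.mono ?_)).inter (d4.mono ?_)).inter (d5.mono ?_)
  · rintro v ⟨u, hu, rfl⟩
    exact Or.inl (Or.inl ⟨u, Or.inl (triSqAnnulusFinset_bcn_subset_slotFrame hk T₀ w hu), rfl⟩)
  · rintro v ⟨u, hu, rfl⟩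
    exact Or.inl (Or.inl ⟨u, Or.inr hu, rfl⟩)
  · intro v hv; exact Or.inl (Or.inr hv)
  · rintro v ⟨u, hu, rfl⟩; exact Or.inr ⟨u, Or.inl hu, rfl⟩
  · rintro v ⟨u, hu, rfl⟩; exact Or.inr ⟨u, Or.inr hu, rfl⟩

namespace InSlot4

variable (P : LParams) (σ : InSlot4)

/-- **The private support of the arm slot `e`** (absolute sites): the image under `viewMap e` of the
support of its corridor in the reading configuration. [cite: Nolin2008, §4.3 Lemma 13 (arXiv 0711.4948: Lemma 12)] -/
def privE (e : Fin 4) : Finset (Site 2) :=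
  (icorrFin4 (σ.fr' e) P.m P.n (σ.k P e) (σ.T P e) P.w (σ.L P e) P.ε (σ.r P e) P.e P.s (σ.ast e) (σ.aln e) (Slot4.bs e) (σ.t P e)
    (σ.W P e)).image (viewMap e)

variable {P σ}

/-- **The corridor of the arm slot `e` is determined by its private support** (`2 ≤ k₀`). [folklore] -/
theorem determinedBy_corrE (hk : 2 ≤ P.k₀) (e : Fin 4) : DeterminedBy (σ.corrE P e) ↑(σ.privE P e) := by
  unfold corrE privE
  rw [Finset.coe_image]
  exact Slot4.determinedBy_preimage_psiCfg e (determinedBy_icorrEvent4 (i := σ.fr' e) (m := P.m) (n := P.n) (k := σ.k P e)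
    (le_trans hk (le_trapScale _ _)) _ _ _ _ _ _ _ _ _ _ _ _)

/-- **Agreement on the shared support and on the framed slot box transports the arm of a slot**
(`2m ≤ N`, `N + N/8 ≤ R`, `fr e < 6`, `os e < 6`, `1 ≤ k₀`). [folklore] -/
theorem armE_of_agree {R : ℕ} (hN : 2 * P.m ≤ P.N) (hR : P.N + P.N / 8 ≤ R) (hk₀ : 1 ≤ P.k₀) {e : Fin 4}
    (hfr : σ.fr e < 6) (hos : σ.os e < 6) {ω ω' : SiteConfig (Site 2)}
    (h : ∀ v ∈ (↑(sharedFin P.m R) : Set (Site 2)) ∪ frameIso (σ.fr e) '' ↑(slotFrame P.m (σ.k P e) (σ.T P e) P.w), v ∈ ω ↔ v ∈ ω')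
    (hω : ω ∈ σ.armE P e) : ω' ∈ σ.armE P e := by
  obtain ⟨z, u, hz, hOut, F, hj, h1, h2, hb⟩ := hω
  have hko : F.k = σ.k P e := by show trapScale P.k₀ F.j = trapScale P.k₀ (σ.sc e); rw [hj]
  have hk1 : 1 ≤ F.k := hko ▸ one_le_trapScale hk₀ _
  -- agreement in the colour-read configuration, framed
  have hcol : ∀ (i : ℕ) (v : Site 2), (frameIso i v ∈ ω ↔ frameIso i v ∈ ω') →
      (v ∈ frameConfig i (colCfg (Slot4.col e) ω) ↔ v ∈ frameConfig i (colCfg (Slot4.col e) ω')) := by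
    intro i v hv
    rw [mem_frameConfig, mem_frameConfig, mem_colCfg, mem_colCfg, hv]
  have hOut' := openVCrossThrough_congr (fun v hv => hcol (σ.os e) v (h _ (Or.inl ?_))) hOut
  swap
  · have := sepOuterFence_subset_sharedFin (m := P.m) (by omega) hR hz hv
    rw [Finset.mem_coe, mem_sharedFin] at this ⊢
    rw [triNorm_frameIso (σ.os e) hos]; exact this
  have hR2 : ((2 * P.m : ℕ) : ℤ) ≤ R := by exact_mod_cast (show 2 * P.m ≤ R by omega)
  push_cast at hR2
  refine ⟨z, u, hz, hOut', F.congr fun v hv => hcol (σ.fr e) v (h _ ?_), hj, h1, h2, hb⟩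
  rcases hv with ((hv | hv) | hv) | hv
  · obtain ⟨x, hx, rfl⟩ := hv
    rw [RelIso.apply_symm_apply]
    left
    have := norm_mem_frame_armRegion hos hN hz x hx
    rw [Finset.mem_coe, mem_sharedFin]
    exact ⟨this.1, this.2.trans (by exact_mod_cast hR)⟩
  · left
    rw [mem_haSet] at hv
    rw [Finset.mem_coe, mem_sharedFin, triNorm_frameIso (σ.fr e) hfr]
    exact ⟨hv.2.1, hv.2.2.trans hR2⟩
  · rw [mem_intFrameZone] at hv
    obtain ⟨hv1, hv2, hv3, hv4, hv5⟩ := hv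
    rcases hv1 with hv1 | ⟨hv1, hv1'⟩
    · left
      rw [mem_haSet] at hv1
      rw [Finset.mem_coe, mem_sharedFin, triNorm_frameIso (σ.fr e) hfr]
      exact ⟨hv1.2.1, hv1.2.2.trans hR2⟩
    · right
      refine ⟨v, ?_, rfl⟩
      rw [mem_hinSet] at hv1
      have := triNorm_lt_iff_lin.1 hv1.2
      obtain ⟨hz0, -, -⟩ := F.z_isIntJ
      rw [Finset.mem_coe, mem_slotFrame (show 1 ≤ σ.k P e from one_le_trapScale hk₀ _), ← hko]
      omega
  · right
    refine ⟨v, ?_, rfl⟩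
    rw [mem_triStrip] at hv
    obtain ⟨hz0, -, -⟩ := F.z_isIntJ
    rw [Finset.mem_coe, mem_slotFrame (show 1 ≤ σ.k P e from one_le_trapScale hk₀ _), ← hko]
    omega

/-- **The arm event of a slot is determined by the shared support and the framed slot box.** [cite: Nolin2008, §4.3 Lemma 13 (arXiv 0711.4948: Lemma 12)] -/
theorem determinedBy_armE {R : ℕ} (hN : 2 * P.m ≤ P.N) (hR : P.N + P.N / 8 ≤ R) (hk₀ : 1 ≤ P.k₀) {e : Fin 4}
    (hfr : σ.fr e < 6) (hos : σ.os e < 6) :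
    DeterminedBy (σ.armE P e) ((↑(sharedFin P.m R) : Set (Site 2)) ∪ frameIso (σ.fr e) '' ↑(slotFrame P.m (σ.k P e) (σ.T P e) P.w)) := by
  rw [determinedBy_iff]
  intro ω ω' hω
  have h : ∀ v ∈ (↑(sharedFin P.m R) : Set (Site 2)) ∪ frameIso (σ.fr e) '' ↑(slotFrame P.m (σ.k P e) (σ.T P e) P.w), v ∈ ω ↔ v ∈ ω' :=
    fun v hv => by
      constructor
      · intro hvω; have : v ∈ ω ∩ _ := ⟨hvω, hv⟩; rw [hω] at this; exact this.1
      · intro hvω; have : v ∈ ω' ∩ _ := ⟨hvω, hv⟩; rw [← hω] at this; exact this.1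
  exact ⟨armE_of_agree hN hR hk₀ hfr hos h, armE_of_agree hN hR hk₀ hfr hos fun v hv => (h v hv).symm⟩

/-- The framed slot box of the arm `e` lies in its private support. [folklore] -/
theorem image_slotFrame_subset_privE {e : Fin 4} (hfr : σ.fr e < 6) :
    frameIso (σ.fr e) '' (↑(slotFrame P.m (σ.k P e) (σ.T P e) P.w) : Set (Site 2)) ⊆ ↑(σ.privE P e) := by
  rintro v ⟨u, hu, rfl⟩
  unfold privE
  rw [Finset.coe_image, coe_icorrFin4]
  refine ⟨viewMap e (frameIso (σ.fr e) u), Or.inl (Or.inl ⟨u, Or.inl hu, ?_⟩), viewMap_viewMap e _⟩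
  unfold viewMap InSlot4.fr'
  by_cases h2 : 2 ≤ (e : ℕ)
  · rw [if_pos h2, if_pos h2, frameIso_add_three hfr]
  · rw [if_neg h2, if_neg h2]

/-- `os e < 6`. [folklore] -/
theorem os_lt (e : Fin 4) : σ.os e < 6 := by
  unfold os Slot4.ts Slot4.bs
  split_ifs <;> omega

end InSlot4

end Literature.Probability.Percolation
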